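import Summits.BirchSwinnertonDyer.BirchSwinnertonDyer.Theorems.ClassRecordThreeEulerHalvesAtThreeWalkSupplyAtThreeKernelGaps
import Summits.BirchSwinnertonDyer.BirchSwinnertonDyer.Theorems.Rank1ResidualJetRingClassFields
import HarnessLib

/-!
# `stub_jetchevMaxHLAtThree` (Jetchev 2008 Thm. 1.4, MAX form at `3 ∥ N`; registered on item 19109
# `EulerHalvesAtThree`) ⟸ SEVEN typed print facts + TWO cite-only named facts (Poitou–Tate, [GZ86 III
# (3.1)]) + the TWO completion-layer KERNEL GAPS — no core-vertex binder, no supply hypothesis, no local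
# print-to-type hypothesis (cell `bsd-stepL`, seat `bsd-stepL-tam3-p1`, helper toward item 19109)

HONEST FRAMING. Nothing here proves BSD, J₃ or the divisibility of any Heegner point; the registered
stub `stub_jetchevMaxHLAtThree` is NOT discharged — it is proved MODULO eleven hypotheses: seven typed
print facts (`h52` McCallum 5.2, `h44` McCallum 4.4, `h53` Gross 5.3, `hD36` Darmon 3.6, `hrec` Gross §3,
`hGZ` Gross–Zagier I (6.3), `hmod` modularity), two cite-only named facts (`hPT` Poitou–Tate for Selmer
structures = the tree's `poitouTate_selmerStructure_duality_conj`; `hGZ31` [GZ86 III (3.1)] receptacle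
schema; ring class fields are number fields by bsd-jet's `JET.numberField_ringClassField`) and the two
completion-layer KERNEL GAPS (`htr` in ROOT form — Howard 2004 Lemma
2.7.3 ∕ [J] Lemma 4.3 for the classes of the `p^u`-th roots; `h49str` — Jetchev Prop. 4.9 proper),
open on every side; no item closes; 0 classes move (T7); `--supports stmt-BirchSwinnertonDyer-19109`.
WHAT THIS FILE DOES. `jetchevMaxHLAtThree_of_facts_of_kernelGaps` = display of record p517133 ∘
`selmerSupplyAtThree_of_kernelGaps` (`…WalkSupplyAtThreeKernelGaps`): every LOCAL print-to-type input of
the kernel §6 walk ([J] Prop. 6.4 ∘ Thm. 6.3 on the row objects) is now a tree theorem — `hloc`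
(bsd-jet pv-1 `JET.kolyvaginLocalTerm_of_poitouTate`), `h𝒯σ` (lit-ty
`JET.forall_conjActPlace_mem_of_eq_iInf_transverseSubgroup`), `h𝒯sd` (ty
`JET.RingClassTransverse.dualTransported_eq_of_localTransverseFamily`), `hΦ` (pv-2
`JET.kodairaNeron_isAddCyclic_forall`), `htrf` (this seat, `Walk.disjoint_kummer_iInf_transverseSubgroup`),
`hPT`-count (this seat, `Walk.natCard_map_localization_signPart_relaxedAt`). Compare bsd-jet's K3 END
FORM re-keyed without `hloc` (`jetchevDivisibilityCarrierMult_of_localFacts_of_poitouTate`, p525384): its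
residual still contains the conjecture-tagged core-vertex reading K5; here K5 is replaced by the kernel
walk, at the price of the ROOT form of `htr`.
References (locators only; no cited FACT is declared): [cite: Jetchev2008, Thm. 1.4 (p. 812), §3.1,
§4.2, Prop. 4.5–4.9, Thm. 5.1, Lemma 5.2, Thm. 6.3, Prop. 6.4, Proof of Thm. 1.4 (pp. 814–825)]
[cite: McCallumLMS1991, §4 Prop. 4.4, §5 Prop. 5.2] [cite: GrossLMS1991, §3, Prop. 5.3, Prop. 6.2 (1)]
[cite: GrossZagier1986, I (6.3), III (3.1)] [cite: Darmon2004, Thm. 3.6, Prop. 3.11]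
[cite: Howard2004HeegnerKolyvagin, Lemma 2.7.3] [cite: MazurRubin2004, Lemma 1.2.4]
[cite: MilneADT2006, Ch. I, Thm. 4.10(b)]. Design: one theorem, no definitions; `K : Type`. Axioms:
`propext`, `Classical.choice`, `Quot.sound`.
-/

set_option autoImplicit false

noncomputable section

open scoped Classical NumberField Pointwise

namespace Summit.BirchSwinnertonDyer.Rank1Residual.X11b.Three.Koly

open WeierstrassCurve IsDedekindDomain NumberField Field Literature.NumberTheory.EllipticCurves
  Literature.NumberTheory.EllipticCurves.ModularForms Literature.NumberTheory.EllipticCurves.Jetchev2008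
  Literature.NumberTheory.EllipticCurves.KolyvaginCocycle
  Literature.NumberTheory.EllipticCurves.Rank1Residual Literature.NumberTheory.GaloisRepresentations
  Literature.NumberTheory.GaloisRepresentations.DiscreteGaloisModule
  Literature.NumberTheory.GaloisCohomology Literature.NumberTheory.Automorphic
  Summit.BirchSwinnertonDyer.Rank1Residual.X11b Summit.BirchSwinnertonDyer.Rank1Residual.JET
  Summit.BirchSwinnertonDyer.Rank1Residual.JET.SelmerVocabulary
  Summit.BirchSwinnertonDyer.Rank1Residual.JET.Walk

set_option maxHeartbeats 800000 in
/-- **`stub_jetchevMaxHLAtThree` VERBATIM ⟸ seven typed print facts + `hPT`/`hGZ31` + the kernel gaps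
`htr` (root form)/`h49str`** — no core-vertex binder, no supply hypothesis, no local
print-to-type hypothesis; see the module docstring. [cite: Jetchev2008, Thm. 1.4 (p. 812), Proof of Thm. 1.4 (p. 825)]
[cite: McCallumLMS1991, §4 Prop. 4.4, §5 Prop. 5.2] [cite: GrossLMS1991, Prop. 5.3]
[cite: GrossZagier1986, III (3.1)] -/
theorem jetchevMaxHLAtThree_of_facts_of_kernelGaps
    -- PRINT FACTS (typed)
    (h52 : McCallum1991.prop52_exists_conductor_kolyvaginClass_order_eq)
    (h44 : McCallum1991.prop44_localOrder_kolyvaginClass_mul_eq)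
    (h53 : ∀ (W : WeierstrassCurve ℚ) (K : Type) [Field K] [NumberField K],
      heegnerPointOfConductor_conj_sub_neg_rootNumber_smul W K)
    (hD36 : ∀ (N : ℕ) [NeZero N] (W : WeierstrassCurve ℚ) (K : Type) [Field K] [NumberField K],
      phi_heegnerTau_mem_singularModuliField N W K)
    (hrec : ∀ (N : ℕ) [NeZero N] (W : WeierstrassCurve ℚ) (K : Type) [Field K] [NumberField K],
      heegnerPointOfConductor_one_galoisConj N W K)
    (hGZ : ∀ (N : ℕ) [NeZero N] (W : WeierstrassCurve ℚ) (K : Type) [Field K] [NumberField K],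
      gross_zagier N W K)
    (hmod : hasEntireLFunction_rat)
    -- NAMED PRINT
    -- NAMED PRINT (cite-only)
    (hPT : ∀ (K : Type) [Field K] [NumberField K], poitouTate_selmerStructure_duality_conj K)
    (hGZ31 : ∀ (W : WeierstrassCurve ℚ) [W.IsElliptic] [NeZero (W.conductorNorm ℤ)]
      (K : Type) [Field K] [NumberField K] (p : ℕ) [Fact p.Prime]
      (Dt : ModularParametrizationData W (W.conductorNorm ℤ)) (β : ℤ) (ι : K →+* ℂ)
      [∀ j : ℕ, NumberField (ringClassField K ι j)],
      ∃ n' : ℤ, IsCoprime (p : ℤ) n' ∧ ∀ (m : ℕ) (dm : KolyvaginHeegnerData Dt β ι m)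
        (γ : ringClassField K ι m ≃ₐ[ℚ] ringClassField K ι m), γ ∈ ringClassGal ι m →
        ∀ v : HeightOneSpectrum (𝓞 K), ¬ (W.baseChange K).HasGoodReductionAt v →
          n' • pointsMap (W.baseChange K) (v.adicCompletion K)
              (dm.toGeomPoints (pointGalHom W (ringClassField K ι m) γ dm.y)) ∈
            E0Receptacle (W.baseChange K) v ∧
          ∀ (ℓ : ℕ), ℓ ∈ m.primeFactors → ∀ (dm' : KolyvaginHeegnerData Dt β ι (m / ℓ))
            (hle : ringClassField K ι (m / ℓ) ≤ ringClassField K ι m),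
            n' • pointsMap (W.baseChange K) (v.adicCompletion K)
                (dm.toGeomPoints (pointGalHom W (ringClassField K ι m) γ
                  (WeierstrassCurve.Affine.Point.map (W' := W)
                    ((RingClassField.inclusion ι hle).restrictScalars ℚ) dm'.y))) ∈
              E0Receptacle (W.baseChange K) v)
    -- the completion-layer KERNEL GAPS
    (htr : ∀ (W : WeierstrassCurve ℚ) [W.IsElliptic] [W.IsGloballyMinimal] [NeZero (W.conductorNorm ℤ)]
      (K : Type) [Field K] [NumberField K], IsImaginaryQuadratic K →
      ∀ (p : ℕ) [Fact p.Prime], p ≠ 2 →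
      ∀ (Dt : ModularParametrizationData W (W.conductorNorm ℤ)) (β : ℤ) (ι : K →+* ℂ)
        [∀ j : ℕ, NumberField (ringClassField K ι j)] (k u : ℕ) (c : ℕ), Squarefree c →
        (∀ ℓ ∈ c.primeFactors, Zhang2014.IsKolyvaginPrime (W.conductorNorm ℤ) W K p ℓ ∧
          k + u ≤ Zhang2014.kolyvaginIndex W p ℓ) →
      ∀ (d : KolyvaginHeegnerData Dt β ι c) (Q : (W.baseChange (ringClassField K ι c)).toAffine.Point)
        (hAk : IsAdmissible (absoluteGaloisGroup K) d.pointsSubgroup ((p ^ k : ℕ) : ℤ))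
        (hQ : d.toGeomPoints Q ∈ invPoints (absoluteGaloisGroup K) d.pointsSubgroup ((p ^ k : ℕ) : ℤ)),
        ((p ^ u : ℕ) : ℤ) • Q = d.derivedPoint →
      ∀ ℓ ∈ c.primeFactors,
        (kolyvaginClass (W.baseChange K) ((p ^ k : ℕ) : ℤ)
            ((W.baseChange K).zsmul_geomPoints_surjective_of_charZero
              (by exact_mod_cast pow_ne_zero k (Fact.out : p.Prime).ne_zero)) hAk (d.toGeomPoints Q) hQ) ∈
          transverseKer W K ι ((p ^ k : ℕ) : ℤ) ℓ)
    (h49str : ∀ (W : WeierstrassCurve ℚ) [W.IsElliptic] [W.IsGloballyMinimal] [NeZero (W.conductorNorm ℤ)]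
      (K : Type) [Field K] [NumberField K], IsImaginaryQuadratic K →
      SatisfiesHeegnerHypothesis (W.conductorNorm ℤ) K →
      ∀ (p : ℕ) [Fact p.Prime], p ≠ 2 →
      ∀ (Dt : ModularParametrizationData W (W.conductorNorm ℤ)) (β : ℤ) (ι : K →+* ℂ)
        [∀ j : ℕ, NumberField (ringClassField K ι j)]
        (k : ℕ) (hn : ((p ^ k : ℕ) : ℤ) ≠ 0) (c : ℕ), Squarefree c →
        (∀ ℓ ∈ c.primeFactors, Zhang2014.IsKolyvaginPrime (W.conductorNorm ℤ) W K p ℓ ∧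
          k ≤ Zhang2014.kolyvaginIndex W p ℓ) →
      ∀ (q : HeightOneSpectrum (𝓞 K)), ((W.conductorNorm ℤ : ℕ) : 𝓞 K) ∈ q.asIdeal →
      ∀ (ℓ : ℕ), Zhang2014.IsKolyvaginPrime (W.conductorNorm ℤ) W K p ℓ →
        k ≤ Zhang2014.kolyvaginIndex W p ℓ → ℓ ∉ c.primeFactors →
      ∀ (d' : KolyvaginHeegnerData Dt β ι (c * ℓ)),
        galoisCohomology.localization ((W.baseChange K).torsionGaloisModule ((p ^ k : ℕ) : ℤ))
            (Sum.inr q) 1 (d'.kolyvaginClass (Fact.out : p.Prime) k) ∈ stringentFamily W K hn (Sum.inr q))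
    :
    ∀ (W : WeierstrassCurve ℚ) [W.IsElliptic] [W.IsGloballyMinimal] [NeZero (W.conductorNorm ℤ)]
      (K : Type) [Field K] [NumberField K]
      (Dt : ModularParametrizationData W (W.conductorNorm ℤ)) (β : ℤ) (ι : K →+* ℂ),
      W.analyticRank = 1 → W.HasMultiplicativeReductionAtPrime 3 → Surj W 3 →
      IsImaginaryQuadratic K → SatisfiesHeegnerHypothesis (W.conductorNorm ℤ) K →
      Odd (NumberField.discr K) → (W.quadraticTwist (NumberField.discr K : ℚ)).entireLFunction 1 ≠ 0 →
      (4 * (W.conductorNorm ℤ : ℤ)) ∣ β ^ 2 - NumberField.discr K → ¬ (3 : ℤ) ∣ Dt.c →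
      ∀ (v : HeightOneSpectrum (𝓞 ℚ)) (s : ℕ), s ≤ padicValNat 3 (W.tamagawaNumberAt v) →
        ∀ (n : ℕ) (d : KolyvaginHeegnerData Dt β ι n), Squarefree n →
          (∀ ℓ ∈ n.primeFactors, Zhang2014.IsKolyvaginPrime (W.conductorNorm ℤ) W K 3 ℓ ∧
            s ≤ Zhang2014.kolyvaginIndex W 3 ℓ) → PDiv d 3 s
      :=
  jetchevMaxHLAtThree_of_facts_of_selmerSupply h52 h44 h53 hD36 hrec hGZ hmod
    (selmerSupplyAtThree_of_kernelGaps (fun K _ _ ι hK j ↦ numberField_ringClassField K hK ι j) hPT hGZ31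
      htr h49str)

end Summit.BirchSwinnertonDyer.Rank1Residual.X11b.Three.Koly

end
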